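import Mathlib

/-!
# Dimock, *The renormalization group according to Balaban* III, §3.4 "final integrals": the explicit per-site integrals
# (span) `(2π)^{−1/2}∫e^{−w²/4}dw = √2`, the box volume `[2λ_j^{−1/4−δ}]^{#sites}`, `𝒩(½a, X) = (√(4π/a))^{|X|}` by translation,
# and their `exp(𝒪(1)(−log λ_j)·#sites)` conversions — PROVED with Lebesgue measure and explicit constants

**Citation header (reproduction of PUBLISHED work; template of the Bałaban lattice Yang–Mills cell).**
J. Dimock, *The renormalization group according to Balaban III. Convergence*, Ann. Henri Poincaré **15** (2014)
2133–2175 (= arXiv:1304.0705v1) [Dimock2013BalabanIII], §3.4 "final integrals" TeX L2068–2155 (TeX source held by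
the cell, `inputs/files/dimock/src/1304.0705/1304.0705.tex`, dfd556282834aeba, 2836 lines).  Dimock's papers are
published and refereed and are the cell's TEMPLATE, not manuscripts under audit; no quantity of the Bałaban series is
touched.

**What the paper prints (verbatim).**  (span) L2069–2078: *"The remaining integral over W_{𝖭,𝛑⁺} in (sally3) is
∫ Π_{j=0}^{𝖭} (2π)^{−|[Ω_{j+1} − Λ_{j+1}]^{(j)}|/2} exp(−¼L^{−(𝖭−j)}|W_j|²_{Ω_{j+1}−Λ_{j+1}}) dW^{(𝖭−j)}_{j,Ω_{j+1}−Λ_{j+1}}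
= Π_{j=0}^{𝖭} 2^{|Ω^{(j)}_{j+1} − Λ^{(j)}_{j+1}|/2}  The last line follows by the change of variables W_j → √2 W_j which takes us
back to a probability measure."*  L2093–2101: *"We do the integrals for j = 𝖭, 𝖭−1, …, 2, 1 in that order. In each case we
first scale up by N−j … Split the integral over Φ_{j,Ω^c_{j+1}} into an integral over Φ_{j,δΩ^c_j} and an integral over
Φ_{j,Ω^c_j}. The first integral is ∫dΦ_{j,δΩ_j} χ̃_j(δΩ_j, Φ_j) = [2λ_j^{−1/4−δ}]^{|(δΩ_j)^{(j)}|} = exp(𝒪(1)(−log λ_j)|(δΩ_j)^{(j)}|)"*;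
L2102–2107: *"The second integral is ∫dΦ_{j,Ω^c_j} exp(−¼a|Φ_j − QΦ_{j−1}|²_{Ω^c_j}) = 𝒩(½a, (Ω^c_j)^{(j)}) = exp(𝒪(1)|(Ω^c_j)^{(j)}|)
These combine to give a bound exp(𝒪(1)(−log λ_j)|(Ω^c_{j+1})^{(j)}|)"*; L2118–2132: *"For the second we have
∫dΦ_{0,Λ^c_0} exp(−½S⁺_0(Λ^c_0, Φ_0)) ≤ ∫dΦ_{0,Λ^c_0} exp(−¼μ̄_0‖Φ_0‖²_{Λ^c_0}) = 𝒩(½μ̄_0, |(Λ^c_0)^{(0)}|) ≤ exp(𝒪(1)(−log μ̄_0)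
|(Λ^c_0)^{(0)}|) ≤ exp(𝒪(1)(−log λ_0)|(Λ^c_0)^{(0)}|)  The last step follows since −log μ̄_0 = 2𝖭 log L ≤ 2(−log λ + 𝖭 log L) =
2(−log λ_0)"*; L2138–2140: *"But |(Ω^c_{j+1})^{(j)}| = L³|(Ω^c_{j+1})^{(j+1)}| ≤ L³|(Λ^c_{j+1})^{(j+1)}| and −log λ_j = −log λ_{j+1} +
log L ≤ −2 log λ_{j+1}."*  Conventions (Theorem 1, L267–268): *"Let 0 < λ < e^{−1} and 0 < μ̄ ≤ 1. Let λ_k = L^{−(𝖭−k)}λ and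
μ̄_k = L^{−2(𝖭−k)}μ̄"*; the small-field characteristic function χ̃_j restricts `|Φ_j| ≤ λ_j^{−1/4−δ}` site by site (§2.2).

**What is reproduced here (kernel-checked, zero `sorry`; Mathlib only).**  Integrals are Lebesgue integrals over
`X → ℝ` for a finite site set `X` (the print's unit-lattice variables after its scalings); products over sites by
Fubini (`integral_fintype_prod_volume_eq_pow` / `_eq_prod`).
* §1 **(span)**: `integral_span_site : ∫ w, (√(2π))⁻¹ e^{−w²/4} dw = √2` and `integral_span : ∫ W, Π_x (√(2π))⁻¹ e^{−W(x)²/4}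
  dW = (√2)^{|X|}` (= `2^{|X|/2}`).
* §2 **the box volume**: `boxInd R φ = χ(|φ| ≤ R)`, `integral_boxInd : ∫ boxInd R = 2R` (`R ≥ 0`), `integral_box : ∫ Π_x
  boxInd R (Φ x) dΦ = (2R)^{|X|}`, and the conversion `box_le_exp`: for `0 < λ ≤ e^{−1}`,
  `(2λ^{−(1/4+δ)})^{|X|} ≤ exp((log 2 + 1/4 + δ)·(−log λ)·|X|)` — *"= exp(𝒪(1)(−log λ_j)|(δΩ_j)^{(j)}|)"* with `𝒪(1) = log 2 + ¼ + δ`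
  (`−log λ ≥ 1` absorbs `log 2`; no sign condition on `δ` is needed for the inequality).
* §3 **`𝒩(½a, X)`**: `integral_gauss_shift_site : ∫ φ, e^{−(a/4)(φ−c)²} dφ = √(4π/a)` (`a > 0`, any shift `c`; translation
  invariance + `integral_gaussian`), `integral_gauss_shift : ∫ Π_x e^{−(a/4)(Φ(x) − c(x))²} dΦ = (√(4π/a))^{|X|}` for any
  `c : X → ℝ` (the print's `QΦ_{j−1}`), `= exp(log √(4π/a) · |X|)` (`gauss_shift_eq_exp`) — *"= 𝒩(½a, (Ω^c_j)^{(j)}) = exp(𝒪(1)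
  |(Ω^c_j)^{(j)}|)"*.
* §4 **the `μ̄_0` integral and its conversions**: `calN_le_exp`: for `0 < μ̄ ≤ e^{−1}`, `(√(4π/μ̄))^{|X|} ≤ exp(((1 + log(4π))/2)·
  (−log μ̄)·|X|)` — *"𝒩(½μ̄_0, ·) ≤ exp(𝒪(1)(−log μ̄_0)|·|)"*; `neg_log_mu0_le`: with `μ̄_0 = L^{−2𝖭}` (`μ̄ = 1`), `λ_0 = L^{−𝖭}λ`,
  `L ≥ 1`, `0 < λ ≤ 1`: `−log μ̄_0 ≤ 2(−log λ_0)` (the printed *"−log μ̄_0 = 2𝖭 log L ≤ 2(−log λ + 𝖭 log L) = 2(−log λ_0)"*).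
* §5 **L2140**: `neg_log_prev_le`: `λ_j = λ_{j+1}/L`, `L > 0`, `0 < λ_{j+1} ≤ L^{−1}` ⇒ `−log λ_j = −log λ_{j+1} + log L ≤ −2 log λ_{j+1}`.
* §6 instances.

**Readings (declared).**  (i) The normalised measures `dW^{(𝖭−j)}`, `dΦ^{(𝖭−j)}` and the scalings *"we first scale up"*
are relabellings; the statements are on the unit lattice with Lebesgue measure per site, where the print evaluates them.
(ii) `𝒩(½a, X)` is read as the Gaussian normalizer `∫exp(−¼a‖Φ − c‖²_X)dΦ = (4π/a)^{|X|/2}`; the print's `exp(𝒪(1)|X|)` is the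
identity with `𝒪(1) = log √(4π/a)` (a constant once `a` is fixed; no sign claimed).  (iii) The explicit constants `log 2 + ¼
+ δ` and `(1 + log 4π)/2` are this file's where the print says `𝒪(1)`; `−log λ ≥ 1` (`λ ≤ e^{−1}`, Theorem 1's hypothesis)
resp. `−log μ̄ ≥ 1` are what makes a constant absorbable into `𝒪(1)(−log ·)`.  (iv) L2140's inequality needs `λ_{j+1} ≤ L^{−1}`,
carried as a hypothesis (true for `λ` small depending on `L`, as in Theorem 1's "λ sufficiently small").

**What is NOT claimed.**  The pointwise step `exp(−½S⁺_0(Λ^c_0, Φ_0)) ≤ exp(−¼μ̄_0‖Φ_0‖²_{Λ^c_0})` (L2121–2123); the assembly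
L2134–2143 and (randall) L2148–2155 (this lineage's `HistorySum` takes (randall)'s shape as input); the counting
`|(Ω^c_{j+1})^{(j)}| = L³|(Ω^c_{j+1})^{(j+1)}|` (L2139; geometry); the order of integration *"j = 𝖭, …, 1"* (Fubini∕Tonelli
bookkeeping across levels); anything of B1–B16 (TEMPLATE.md §4.3 rows «D3 §3.2–3.3», «D3 §3.5»).  NOT summit progress; NOT a
statement about any Bałaban paper; NOT continuum; NOT Clay.  Unit `b2b-balaban-template` gen 30 (journal CLAIM
D3-FINAL-INTEGRALS-KERNEL).

**Version.**  v1.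
-/

noncomputable section

open MeasureTheory Real Finset

namespace Literature.MathematicalPhysics.QuantumFieldTheory.Dimock2011to13.FinalIntegrals

/-! ## §1 (span): `(2π)^{−1/2}∫e^{−w²/4} dw = √2` per site -/

/-- `∫ e^{−b w²} dw = √(π/b)` in the form used here. [folklore] -/
private theorem integral_exp_neg_mul_sq_div (b : ℝ) :
    ∫ w : ℝ, Real.exp (-(b * w ^ 2)) = √(π / b) := by
  have h := integral_gaussian b
  have h2 : (fun x : ℝ => Real.exp (-b * x ^ 2)) = fun x => Real.exp (-(b * x ^ 2)) := by
    funext x; congr 1; ring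
  rw [h2] at h
  exact h

/-- **(span), one site**: `(2π)^{−1/2}∫exp(−¼w²)dw = √2` — *"by the change of variables W_j → √2W_j which takes us back to a
probability measure"*. [cite: Dimock2013BalabanIII, §3.4 (span) L2069–2078 (arXiv:1304.0705v1 TeX)] -/
theorem integral_span_site : ∫ w : ℝ, (√(2 * π))⁻¹ * Real.exp (-(w ^ 2 / 4)) = √2 := by
  rw [integral_const_mul]
  have h : ∫ w : ℝ, Real.exp (-(w ^ 2 / 4)) = √(π / (1 / 4)) := by
    rw [← integral_exp_neg_mul_sq_div (1 / 4)]
    congr 1; funext w; congr 1; ring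
  have hs : (0 : ℝ) < √(2 * π) := by positivity
  rw [h, show π / (1 / 4) = 2 * (2 * π) by ring, Real.sqrt_mul (by norm_num : (0:ℝ) ≤ 2) (2 * π),
    mul_left_comm, inv_mul_cancel₀ hs.ne', mul_one]

variable {X : Type*} [Fintype X]

/-- **(span)**: `∫ Π_x (2π)^{−1/2} exp(−¼W(x)²) dW = (√2)^{|X|} = 2^{|X|/2}` over the sites of `Ω_{j+1} − Λ_{j+1}`.
[cite: Dimock2013BalabanIII, §3.4 (span) L2069–2078 (arXiv:1304.0705v1 TeX)] -/
theorem integral_span :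
    ∫ W : X → ℝ, ∏ x, (√(2 * π))⁻¹ * Real.exp (-(W x ^ 2 / 4)) = √2 ^ Fintype.card X := by
  rw [← integral_span_site]
  exact integral_fintype_prod_volume_eq_pow (fun w : ℝ => (√(2 * π))⁻¹ * Real.exp (-(w ^ 2 / 4)))

/-! ## §2 The box volume `[2λ_j^{−1/4−δ}]^{#sites}` and its `exp(𝒪(1)(−log λ_j)·#sites)` form -/

/-- the small-field indicator at one site: `χ(|φ| ≤ R)` (the print's `χ̃_j` restricts `|Φ_j| ≤ λ_j^{−1/4−δ}`).
[cite: Dimock2013BalabanIII, §3.4 L2098–2100 (arXiv:1304.0705v1 TeX)] -/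
def boxInd (R φ : ℝ) : ℝ := if |φ| ≤ R then 1 else 0

/-- `boxInd R` is the indicator of `[−R, R]`. [folklore] -/
private theorem boxInd_eq_indicator (R : ℝ) : boxInd R = (Set.Icc (-R) R).indicator fun _ => (1 : ℝ) := by
  funext φ
  unfold boxInd
  by_cases h : |φ| ≤ R
  · rw [if_pos h, Set.indicator_of_mem (show φ ∈ Set.Icc (-R) R from Set.mem_Icc.mpr (abs_le.mp h))]
  · rw [if_neg h, Set.indicator_of_notMem
      (show φ ∉ Set.Icc (-R) R from fun hm => h (abs_le.mpr (Set.mem_Icc.mp hm)))]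

/-- **one site**: `∫ χ(|φ| ≤ R) dφ = 2R` (`R ≥ 0`). [cite: Dimock2013BalabanIII, §3.4 L2098–2100 (arXiv:1304.0705v1 TeX)] -/
theorem integral_boxInd {R : ℝ} (hR : 0 ≤ R) : ∫ φ : ℝ, boxInd R φ = 2 * R := by
  rw [boxInd_eq_indicator, integral_indicator measurableSet_Icc, setIntegral_const, smul_eq_mul, mul_one,
    measureReal_def, Real.volume_Icc, ENNReal.toReal_ofReal (by linarith)]
  ring

/-- **the box volume**: `∫ Π_x χ(|Φ(x)| ≤ R) dΦ = (2R)^{|X|}` — *"∫dΦ_{j,δΩ_j} χ̃_j(δΩ_j, Φ_j) = [2λ_j^{−1/4−δ}]^{|(δΩ_j)^{(j)}|}"* with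
`R = λ_j^{−1/4−δ}`. [cite: Dimock2013BalabanIII, §3.4 L2098–2100 (arXiv:1304.0705v1 TeX)] -/
theorem integral_box {R : ℝ} (hR : 0 ≤ R) :
    ∫ Φ : X → ℝ, ∏ x, boxInd R (Φ x) = (2 * R) ^ Fintype.card X := by
  rw [← integral_boxInd hR]
  exact integral_fintype_prod_volume_eq_pow (boxInd R)

/-- **`[2λ^{−1/4−δ}]^{#sites} = exp(𝒪(1)(−log λ)·#sites)`** with the explicit `𝒪(1) = log 2 + ¼ + δ`, for `0 < λ ≤ e^{−1}` (any
real `δ`): `(2λ^{−(1/4+δ)})^{|X|} ≤ exp((log 2 + 1/4 + δ)(−log λ)|X|)`. [cite: Dimock2013BalabanIII, §3.4 L2098–2100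
(arXiv:1304.0705v1 TeX)] -/
theorem box_le_exp {lam : ℝ} (hlam : 0 < lam) (hlam1 : lam ≤ Real.exp (-1)) (δ : ℝ) (n : ℕ) :
    (2 * lam ^ (-(1 / 4 + δ))) ^ n ≤ Real.exp ((Real.log 2 + 1 / 4 + δ) * (-Real.log lam) * n) := by
  -- −log λ ≥ 1
  have hlog : 1 ≤ -Real.log lam := by
    have := Real.log_le_log hlam hlam1
    rw [Real.log_exp] at this; linarith
  -- 2λ^{−(1/4+δ)} = exp(log 2 + (1/4+δ)(−log λ)) ≤ exp((log 2 + 1/4 + δ)(−log λ))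
  have h1 : 2 * lam ^ (-(1 / 4 + δ)) = Real.exp (Real.log 2 + (1 / 4 + δ) * (-Real.log lam)) := by
    rw [Real.exp_add, Real.exp_log (by norm_num : (0:ℝ) < 2), Real.rpow_def_of_pos hlam]
    congr 1; congr 1; ring
  have h2 : Real.log 2 + (1 / 4 + δ) * (-Real.log lam) ≤ (Real.log 2 + 1 / 4 + δ) * (-Real.log lam) := by
    have hl2 : 0 ≤ Real.log 2 := Real.log_nonneg (by norm_num)
    nlinarith
  rw [h1, ← Real.exp_nat_mul, mul_comm (n : ℝ), Real.exp_le_exp]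
  exact mul_le_mul_of_nonneg_right h2 (Nat.cast_nonneg n)

/-! ## §3 `𝒩(½a, X)`: the shifted Gaussian by translation invariance -/

/-- **one site**: `∫ exp(−¼a(φ − c)²) dφ = √(4π/a)` for `a > 0` and ANY shift `c` (translation invariance of Lebesgue measure;
the print's shift is `(QΦ_{j−1})(x)`). [cite: Dimock2013BalabanIII, §3.4 L2102–2105 (arXiv:1304.0705v1 TeX)] -/
theorem integral_gauss_shift_site {a : ℝ} (ha : 0 < a) (c : ℝ) :
    ∫ φ : ℝ, Real.exp (-(a / 4 * (φ - c) ^ 2)) = √(4 * π / a) := by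
  rw [integral_sub_right_eq_self (μ := volume) (fun φ : ℝ => Real.exp (-(a / 4 * φ ^ 2))) c,
    integral_exp_neg_mul_sq_div (a / 4)]
  congr 1; field_simp

/-- **`𝒩(½a, X)`**: `∫ Π_x exp(−¼a(Φ(x) − c(x))²) dΦ = (√(4π/a))^{|X|}` for any `c : X → ℝ` — *"∫dΦ_{j,Ω^c_j} exp(−¼a|Φ_j −
QΦ_{j−1}|²_{Ω^c_j}) = 𝒩(½a, (Ω^c_j)^{(j)})"*. [cite: Dimock2013BalabanIII, §3.4 L2102–2105 (arXiv:1304.0705v1 TeX)] -/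
theorem integral_gauss_shift {a : ℝ} (ha : 0 < a) (c : X → ℝ) :
    ∫ Φ : X → ℝ, ∏ x, Real.exp (-(a / 4 * (Φ x - c x) ^ 2)) = √(4 * π / a) ^ Fintype.card X := by
  rw [integral_fintype_prod_volume_eq_prod (fun x (φ : ℝ) => Real.exp (-(a / 4 * (φ - c x) ^ 2)))]
  simp_rw [integral_gauss_shift_site ha]
  rw [Finset.prod_const, Finset.card_univ]

/-- **`𝒩(½a, X) = exp(𝒪(1)|X|)`** with `𝒪(1) = log √(4π/a)` (an identity). [cite: Dimock2013BalabanIII, §3.4 L2104–2105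
(arXiv:1304.0705v1 TeX)] -/
theorem gauss_shift_eq_exp {a : ℝ} (ha : 0 < a) (c : X → ℝ) :
    ∫ Φ : X → ℝ, ∏ x, Real.exp (-(a / 4 * (Φ x - c x) ^ 2))
      = Real.exp (Real.log (√(4 * π / a)) * Fintype.card X) := by
  have hpos : 0 < √(4 * π / a) := by positivity
  rw [integral_gauss_shift ha,
    show Real.log (√(4 * π / a)) * (Fintype.card X : ℝ) = (Fintype.card X : ℝ) * Real.log (√(4 * π / a)) from
      mul_comm _ _, Real.exp_nat_mul, Real.exp_log hpos]

/-! ## §4 The `μ̄_0` integral: `𝒩(½μ̄_0, X) ≤ exp(𝒪(1)(−log μ̄_0)|X|) ≤ exp(𝒪(1)(−log λ_0)|X|)` -/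

/-- **`𝒩(½μ̄, X) ≤ exp(𝒪(1)(−log μ̄)|X|)`** with `𝒪(1) = (1 + log 4π)/2`, for `0 < μ̄ ≤ e^{−1}`:
`(√(4π/μ̄))^{|X|} ≤ exp(((1 + log(4π))/2)(−log μ̄)|X|)`. [cite: Dimock2013BalabanIII, §3.4 L2118–2126 (arXiv:1304.0705v1 TeX)] -/
theorem calN_le_exp {mu : ℝ} (hmu : 0 < mu) (hmu1 : mu ≤ Real.exp (-1)) (n : ℕ) :
    √(4 * π / mu) ^ n ≤ Real.exp ((1 + Real.log (4 * π)) / 2 * (-Real.log mu) * n) := by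
  have hlog : 1 ≤ -Real.log mu := by
    have := Real.log_le_log hmu hmu1
    rw [Real.log_exp] at this; linarith
  have hπ : (0 : ℝ) < 4 * π := by positivity
  have hpos : 0 < √(4 * π / mu) := by positivity
  -- √(4π/μ̄) = exp(½(log 4π − log μ̄))
  have h1 : √(4 * π / mu) = Real.exp ((Real.log (4 * π) + -Real.log mu) / 2) := by
    rw [Real.sqrt_eq_rpow, Real.rpow_def_of_pos (by positivity), Real.log_div hπ.ne' hmu.ne']
    congr 1; ring
  have hl4 : 0 ≤ Real.log (4 * π) := by
    refine Real.log_nonneg ?_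
    have := Real.pi_gt_three; linarith
  have h2 : (Real.log (4 * π) + -Real.log mu) / 2 ≤ (1 + Real.log (4 * π)) / 2 * (-Real.log mu) := by
    nlinarith
  rw [h1, ← Real.exp_nat_mul, mul_comm (n : ℝ), Real.exp_le_exp]
  exact mul_le_mul_of_nonneg_right h2 (Nat.cast_nonneg n)

/-- **L2129–2131**: with `μ̄_0 = L^{−2𝖭}` (`μ̄ = 1`) and `λ_0 = L^{−𝖭}λ`, `L ≥ 1`, `0 < λ ≤ 1`:
`−log μ̄_0 = 2𝖭 log L ≤ 2(−log λ + 𝖭 log L) = 2(−log λ_0)`. [cite: Dimock2013BalabanIII, §3.4 L2129–2132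
(arXiv:1304.0705v1 TeX)] -/
theorem neg_log_mu0_le {L lam : ℝ} (hL : 1 ≤ L) (hlam : 0 < lam) (hlam1 : lam ≤ 1) (N : ℕ) :
    -Real.log ((L ^ (2 * N))⁻¹) ≤ 2 * -Real.log ((L ^ N)⁻¹ * lam) := by
  have hL0 : 0 < L := by linarith
  rw [Real.log_inv, neg_neg, Real.log_mul (by positivity) hlam.ne', Real.log_inv, Real.log_pow, Real.log_pow]
  have h1 : Real.log lam ≤ 0 := Real.log_nonpos hlam.le hlam1
  push_cast
  nlinarith [Real.log_nonneg hL]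

/-! ## §5 L2140: `−log λ_j = −log λ_{j+1} + log L ≤ −2 log λ_{j+1}` -/

/-- **L2140**: `λ_j = λ_{j+1}/L` gives `−log λ_j = −log λ_{j+1} + log L`, and `≤ −2 log λ_{j+1}` as soon as `λ_{j+1} ≤ L^{−1}`.
[cite: Dimock2013BalabanIII, §3.4 L2138–2140 (arXiv:1304.0705v1 TeX)] -/
theorem neg_log_prev_le {L lamNext : ℝ} (hL : 0 < L) (hlam : 0 < lamNext) (hsmall : lamNext ≤ L⁻¹) :
    -Real.log (lamNext / L) = -Real.log lamNext + Real.log L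
      ∧ -Real.log (lamNext / L) ≤ -2 * Real.log lamNext := by
  have h1 : -Real.log (lamNext / L) = -Real.log lamNext + Real.log L := by
    rw [Real.log_div hlam.ne' hL.ne']; ring
  refine ⟨h1, ?_⟩
  rw [h1]
  -- log L ≤ −log λ_{j+1} ⇔ λ_{j+1} ≤ L⁻¹
  have h2 : Real.log lamNext ≤ Real.log L⁻¹ := Real.log_le_log hlam hsmall
  rw [Real.log_inv] at h2
  linarith

/-! ## §6 Instances -/

/-- two sites: `∫∫ (2π)^{−1} e^{−(u²+v²)/4} = 2`. -/
example : ∫ W : Fin 2 → ℝ, ∏ x, (√(2 * π))⁻¹ * Real.exp (-(W x ^ 2 / 4)) = 2 := by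
  rw [integral_span, Fintype.card_fin, Real.sq_sqrt (by norm_num)]

/-- the box of side `2R = 2` in three variables has volume `8`. -/
example : ∫ Φ : Fin 3 → ℝ, ∏ x, boxInd 1 (Φ x) = 8 := by
  rw [integral_box zero_le_one, Fintype.card_fin]; norm_num

end Literature.MathematicalPhysics.QuantumFieldTheory.Dimock2011to13.FinalIntegrals

end
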